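import Literature.MathematicalPhysics.QuantumFieldTheory.Balaban1983to89.T3LogComparisonSocket
import HarnessLib

/-!
# `Balaban1983to89.T3AlphaInputsAC` — THE T3-PINNED (α) SOCKET `defn-AlphaInputsT3AC`: Bałaban's small-field RG representation data of
# [Balaban1985UV3] (38)–(43), (47), (62)–(65), (67)–(68) EXPOSED AS DATA over the route's pinned carrier (`T3Family`, `blockAvg ℰp`,
# `resDensity`/`heightDensity`), and the envelopes / locality / size clauses the cruxes 18916 `HistoryTail` and 19201
# `FluctuationComparisonRegPr` consume, as HYPOTHESIS SCHEMAS (never asserted)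

Work item `defn-AlphaInputsT3AC` (kind definition; wanted by stmt-QuantumFields-18916 / -19201), typed to the route owner's SHAPE SPEC
`pub/ym3-torus/route-R3/ym/plan-g14/AlphaInputsT3AC-SHAPE.md` (79ec68554fb53705, clauses (1)–(4)), OWNER RULING g15-№1 (2026-08-26: interface =
this shape, locality clause REQUIRED) and the consumer contracts (`pub/ym-fleet/ym-ust-18916-p1/CONTRACT-18916-AlphaDataT3.md` A1–A3, B1–B6,
C1–C3; ★ym-ust-19201-p2's socket `T3LogComparisonSocket`); page dossier `pub/lit-balaban/ALPHA-T3AC-PAGES.md` (5fdf576faff4513c).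

WHAT THIS FILE IS.  (1) PINNED CARRIER: the family `F : T3Family` (runs `F.P K`), fields `GaugeField (F.P K) j SU(2)`, the averaging of record
`BlockAveraging.blockAvg ℰp` iterated (`Averaging.iter`), the route's un-normalised renormalised densities `resDensity F γ K univ j` (Bałaban's
`ρ_j = T^jρ₀` of (2) p.256 for the `ℰp` averaging) and their height readings `heightDensity` — NO free `ExternalInputs.av`.  (2) THE (41)-DATA AS
DATA: the structure `AlphaDataT3 F γ` = the printed objects of (38)–(43), (47), (62)–(64) in run-`K` level currency `(K, j) ↦ (GaugeField (F.P K)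
j SU(2) → ℝ)` — histories `Hist`/`triv`, regions `Ω` (read on the fine torus as `B10Eq38TorusDomains`/`B10Eq42TorusConstraint` read them),
admissibility `Adm`, the history functional `LF` of (41), the composite minimiser `Umin` of (42), `mainT = (1/g_j²)A^η(U_j)`, the interaction sum
`Pint` of (43) with its localised terms `Pterm`, domains `Loc`, enlargement `enl` and linear size `treeLen` ((24)–(25) p.262, p.263), `Zterm`,
the characteristic function `χ` of (47), `Estep = E^{(i)}` (62), `Ecst = E_j` (64), `Rm` = the remainder of (41)/(47).  NOTHING about these data
is asserted by the structure: it is a SIGNATURE.  `up`/`low` (contract A1/A2), `PintTriv`, `Λ := lam42 Ω` and the height-`n` readings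
`PintH/EcstH/RmH` (via `fieldShift`, exactly as `heightDensity` reads `resDensity`) are DEFINED from the fields.  (3) SCHEMAS (`def … : Prop`,
never asserted, each with its printed sentence): (41′)/(47′) for `resDensity … univ j` with the constants pulled out (B1/B2; the shapes
`HistoryTailSandwich.rho_le_of_ineq41/le_rho_of_ineq47` produce from `B10.Ineq41/Ineq47`), regularity of `low`/`up` (B3–B5), the printed SIZE
facts (`RmSize` (41)+(5), `EcstSize` (64)–(65), `PintSize` (46)), the REQUIRED LOCALITY clause (`PintDecomp` (43), `IsLocal` p.263, `GaugeInv26`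
(26), `TermSize` (44)), the (42)/(67) constraint and the `(1/g²)A^η` identification of the main term (C1), print's regularity (68) (C2, plus the
consumer's multi-level READING), the shape of `LF` (C3), and the 19201 reading `RepAtHeights := TwoSidedRepAt F γ b₀ p₀ ε₀ PintH EcstH RmH`
(SPEC (3a) THROUGH the existing socket, not restated).  (4) COMPATIBILITY: Haar ABSOLUTE CONTINUITY of the pinned averaging is the tree's
`T3UnitLawDensityEML.haarAC_blockAvg`; exact `av_map` is assumed nowhere; the V-integral normalisation of [Balaban1985Averaging] (10) p.19
enters only through `resDensity` (a push-forward density by construction, `T3RestrictedUnitDensity.integral_towerDensity_mul`).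

WHAT THIS FILE IS NOT.  No estimate of Bałaban's is asserted; no `instance`, no notation; no named fact (the `def … : Prop` are predicates ON
EXPOSED DATA, instantiated by whoever CONSTRUCTS an `AlphaDataT3` — SPEC (5): the construction statement is pub-balaban3d's Summit-side layer,
not this item).  The `theorem`s are bookkeeping (B3 from `χ ∈ [0,1]`, B4 on events, B6 from `RmSize`, (68) from the multi-level reading).
HONEST FRAMING: the schemas type (41)/(43)/(44)/(47)/(65)/(68) AS PRINTED for print's objects read at the route's pinned `ℰp` densities; that
they HOLD for the `ℰp` densities of `SU(2)` on `T³` is Bałaban's Theorem 2 p.272 for HIS averaging — for `ℰp` it is the construction statement,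
located-unprinted at the exact-Haar-compatibility point (fleet finding af2a5b6fdc02c5ee; NODE O P2/P3; dossier §4).

References: T. Bałaban, CMP 102 (1985) 255–275 [Balaban1985UV3] ((24)–(26) pp.262–263, (38)–(47) pp.266–267, (62)–(66) pp.271–273, (67)–(71)
p.273, Thm 2 p.272); T. Bałaban, CMP 102 (1985) 277–309 [Balaban1985Variational] ((3), (6) p.278); T. Bałaban, CMP 98 (1985) 17–51
[Balaban1985Averaging] ((10) p.19); C. King, CMP 102 (1986) 649–677 [King1986] (Thm 3.4 p.656).
-/

noncomputable section

open MeasureTheory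
open Literature.MathematicalPhysics.QuantumFieldTheory.Balaban1983to89.T3ContinuumYM3Torus
open Literature.MathematicalPhysics.QuantumFieldTheory.Balaban1983to89.T3UnitLawDensityEML (ℰp measurableE_ℰp)
open Literature.MathematicalPhysics.QuantumFieldTheory.Balaban1983to89.T3UnitScaleTilt
open Literature.MathematicalPhysics.QuantumFieldTheory.Balaban1983to89.T3TiltDescent
open Literature.MathematicalPhysics.QuantumFieldTheory.Balaban1983to89.T3LevelShift
open Literature.MathematicalPhysics.QuantumFieldTheory.Balaban1983to89.T3RestrictedUnitDensity
open Literature.MathematicalPhysics.QuantumFieldTheory.Balaban1983to89.T3PrintedRegularMinimiser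
open Literature.MathematicalPhysics.QuantumFieldTheory.Balaban1983to89.T3LogComparisonSocket
open Literature.MathematicalPhysics.QuantumFieldTheory.Balaban1983to89.B10Eq38TorusDomains (toFine cornerSet plaqsIn)
open Literature.MathematicalPhysics.QuantumFieldTheory.Balaban1983to89.B10Eq42TorusConstraint (bondsIn lam42)

namespace Literature.MathematicalPhysics.QuantumFieldTheory.Balaban1983to89.T3AlphaInputsAC

/-! ## §1 The (41)-data of the `ℰp` densities, EXPOSED AS DATA (a signature; nothing asserted) -/

/-- **BAŁABAN'S SMALL-FIELD RG REPRESENTATION DATA OF RUN `K` AT LEVEL `j`, PINNED TO THE ROUTE'S CARRIER** — the printed objects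
of [Balaban1985UV3] (38)–(43), (47), (62)–(64) as a SIGNATURE (a bundle of functions; no property of them and nothing about the densities is
asserted).  Index convention: `(K, j)` = run `K` (parameters `F.P K`, `ε_K = L^{−K}`) after `j` renormalisation steps (print's `k`), fields
`W : GaugeField (F.P K) j SU(2)` (print's `V`); route units `β_K = (F.scheme ℰp γ).β K` (print's `1/g_k²` inside `mainT`).  Print, p.266: «a
sequence of domains Ω₁ ⊃ Ω₂ ⊃ … ⊃ Ω_k, Ω_j ⊂ T_η … Λ_j = Ω_j^{(j)}∖Ω_{j+1}^{(j)}, Z_j = Ω_{j+1}^{(j)c}» (38)–(40); (41) «ρ_k(V) ≤ Σ_{{Ω_j}}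
∫dV_{k−1}↾_{Z_{k−1}} δ(V̄_{k−1}V^{−1}) ⋯ ∫dV₀↾_{Z₀} δ(V̄₀V₁^{−1}) χ_k ζ_{Λ_{k−1}} χ_{k−1} ⋯ ζ_{Λ₁} χ₁ ζ_{Ω₁^c} exp[−(1/g_k²)A^η(U_k) + Σ_{j=1}^{k} Σ_{Y_j}
𝒫_j(Y_j, U_k) − E_k + Σ_{j<k} O(log g_j^{−1})|Z_j| + Σ_{j<k} O((Lʲε)^{3+κ₀})|T₁^{(j)}|]»; (42) «it is a minimum of the functional U ↦ A(U) with the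
restrictions U: Ū_j = V_j on Λ_j, j = 0, 1, …, k, where we have put Λ₀ = Ω₁^c and V_k = V»; (43) the terms `𝒫_j(Y_j, U_k)`; (47) p.267 «the
characteristic function χ_k corresponds to the restrictions on V given by the conditions |U_k(∂p) − 1| < g_k p(g_k)η², p ⊂ T_η»; (62) p.271
`E^{(k)}`; (64) p.273 «E_k = Σ_{j=k}^{K−1} E^{(j)}»; the trivial history = all `Ω_i = T_η`, all `Z_i = ∅` (p.272 «all simplifications coming from
the fact that Ω_{k+1} = T_η»). [cite: Balaban1985UV3, (38)-(43) p.266, (47) p.267, (62) p.271, (64) p.273] -/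
structure AlphaDataT3 (F : T3Family) (γ : ℝ) where
  /-- The large-field histories of run `K` below level `j` ((38)–(40) p.266). -/
  Hist : ℕ → ℕ → Type
  /-- The trivial history (no large fields; the term of (47)). -/
  triv : (K j : ℕ) → Hist K j
  /-- The regions `Ω_i(h) ⊂ T_η`, `i ≤ j`, of a history, read on the fine torus of run `K` ((38) p.266). -/
  Ω : (K j : ℕ) → Hist K j → ℕ → Set (Site (F.P K) 0)
  /-- Admissibility: `(h, W)` is in the support of the characteristic functions of (41) ((40) p.266). -/
  Adm : (K j : ℕ) → Hist K j → GaugeField (F.P K) j (Matrix.specialUnitaryGroup (Fin 2) ℂ) → Prop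
  /-- The history functional of (41): sum over regions and conditional large-field integrals, characteristic functions included,
  applied to `exp ∘ Φ`. -/
  LF : (K j : ℕ) → GaugeField (F.P K) j (Matrix.specialUnitaryGroup (Fin 2) ℂ) → (Hist K j → ℝ) → ℝ
  /-- The composite minimal configuration `U_k(V, {V_j})` of (42) on the fine torus. -/
  Umin : (K j : ℕ) → Hist K j → GaugeField (F.P K) j (Matrix.specialUnitaryGroup (Fin 2) ℂ) →
    GaugeField (F.P K) 0 (Matrix.specialUnitaryGroup (Fin 2) ℂ)
  /-- The main term `(1/g_k²)A^η(U_k)` of (41)/(47). -/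
  mainT : (K j : ℕ) → Hist K j → GaugeField (F.P K) j (Matrix.specialUnitaryGroup (Fin 2) ℂ) → ℝ
  /-- The interaction sum `Σ_{j≤k}Σ_{Y_j}𝒫_j(Y_j, U_k)` of (43). -/
  Pint : (K j : ℕ) → Hist K j → GaugeField (F.P K) j (Matrix.specialUnitaryGroup (Fin 2) ℂ) → ℝ
  /-- The localisation domains `Y_i` of level `i` summed in (43) for the history `h` (p.266: «y represents big blocks of the Lʲη-lattice,
  contained in Ω_k, … and c_i are bonds in Ω_k^{(j)}»; p.262: «Localizations X are connected unions of big blocks»), read as point sets of the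
  fine torus. -/
  Loc : (K j : ℕ) → Hist K j → ℕ → Finset (Set (Site (F.P K) 0))
  /-- THE INDIVIDUAL INTERACTION TERMS `𝒫_i(Y, U)` of (24)/(33)/(43) as functionals of a FINE configuration `U` (evaluated in (41) at the
  composite minimiser `U = U_k(h, W)`; history-independent, as in print). -/
  Pterm : (K i : ℕ) → Set (Site (F.P K) 0) → GaugeField (F.P K) 0 (Matrix.specialUnitaryGroup (Fin 2) ℂ) → ℝ
  /-- Print's enlargement `X ↦ X̃ = ∪_{□⊂X} □̃` of a level-`i` localisation (p.263: «𝒫₁(g₀, X, U₁) depends on U₁ restricted to the set X̃»). -/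
  enl : (K i : ℕ) → Set (Site (F.P K) 0) → Set (Site (F.P K) 0)
  /-- Print's LINEAR SIZE `𝓛(Y)` of a level-`i` localisation (p.262: «the length of a shortest tree graph connecting the centers of big
  blocks in X …, if the big blocks are scaled to unit cubes»). -/
  treeLen : (K i : ℕ) → Set (Site (F.P K) 0) → ℝ
  /-- The large-field term `Σ_{j<k} O(log g_j⁻¹)|Z_j|` of (41). -/
  Zterm : (K j : ℕ) → Hist K j → ℝ
  /-- The characteristic function `χ_k` of (47). -/
  χ : (K j : ℕ) → GaugeField (F.P K) j (Matrix.specialUnitaryGroup (Fin 2) ℂ) → ℝ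
  /-- The one-step vacuum-energy constants `E^{(i)}` of (62), run `K`. -/
  Estep : ℕ → ℕ → ℝ
  /-- The constants `E_k` of (41)/(47), (64). -/
  Ecst : ℕ → ℕ → ℝ
  /-- The remainders `Σ_{j<k} O((Lʲε)^{3+κ₀})|T₁^{(j)}|` of (41)/(47). -/
  Rm : ℕ → ℕ → ℝ

namespace AlphaDataT3

variable {F : T3Family} {γ : ℝ} (D : AlphaDataT3 F γ)

/-- **THE (41) MAJORANT WITHOUT THE CONSTANTS** (18916 contract A1): `up_j(W) = LF_j(W)[exp(−mainT + Pint + Zterm)]` — the right side of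
(41) p.266 with `e^{−E_k}` and the remainder pulled out of the exponential. [cite: Balaban1985UV3, (41) p.266] -/
def up (K j : ℕ) (W : GaugeField (F.P K) j (Matrix.specialUnitaryGroup (Fin 2) ℂ)) : ℝ :=
  D.LF K j W fun h => -(D.mainT K j h W) + D.Pint K j h W + D.Zterm K j h

/-- **THE (47) MINORANT WITHOUT THE CONSTANTS** (18916 contract A2): `low_j(W) = χ_j(W)·exp(−mainT(triv) + Pint(triv))` — the right side
of (47) p.267 with `e^{−E_k}` and the remainder pulled out. [cite: Balaban1985UV3, (47) p.267] -/
def low (K j : ℕ) (W : GaugeField (F.P K) j (Matrix.specialUnitaryGroup (Fin 2) ℂ)) : ℝ :=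
  D.χ K j W * Real.exp (-(D.mainT K j (D.triv K j) W) + D.Pint K j (D.triv K j) W)

/-- The interaction sum AT THE TRIVIAL HISTORY, `Σ_{j≤k}Σ_Y 𝒫_j(Y, U_k(V))` with `U_k(V)` the plain minimiser (19201's `PintT3`).
[cite: Balaban1985UV3, (43) p.266] -/
def PintTriv (K j : ℕ) (W : GaugeField (F.P K) j (Matrix.specialUnitaryGroup (Fin 2) ℂ)) : ℝ :=
  D.Pint K j (D.triv K j) W

/-- Print's regions `Λ_i(h)` of (42): `Λ_i = Ω_i ∖ Ω_{i+1}` (`i < j`), `Λ_j = Ω_j` (the tree's `lam42`). [cite: Balaban1985UV3, (40)-(42) p.266] -/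
def Λ (K j : ℕ) (h : D.Hist K j) : ℕ → Set (Site (F.P K) 0) :=
  lam42 (D.Ω K j h) j

/-- **THE HEIGHT-`n` READING OF THE TRIVIAL-HISTORY INTERACTION SUM** on the `n`-th tower's finest lattice (`T3TiltDescent.heightDensity`'s
reading of `resDensity`, same `fieldShift`): run `K`, `k = K − n` steps done — the argument `Pint` of `T3LogComparisonSocket.TwoSidedRepAt`.
[cite: Balaban1985UV3, (43) p.266] -/
def PintH (K n : ℕ) (V : GaugeField (F.P n) 0 (Matrix.specialUnitaryGroup (Fin 2) ℂ)) : ℝ :=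
  if h : n ≤ K then
    D.PintTriv K (K - n)
      (fieldShift (F.sitesPerDir_eq (m := F.m) (K := K) (j := K - n) (m' := F.m) (K' := n) (j' := 0) (by omega)) V)
  else 0

/-- The height-`n` reading of `E_k`, `k = K − n` (the argument `E` of `TwoSidedRepAt`). [cite: Balaban1985UV3, (64) p.273] -/
def EcstH (K n : ℕ) : ℝ := D.Ecst K (K - n)

/-- The height-`n` reading of the remainder, `k = K − n` (the argument `Rm` of `TwoSidedRepAt`). [cite: Balaban1985UV3, (41) p.266] -/
def RmH (K n : ℕ) : ℝ := D.Rm K (K - n)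

/-- `PintH` below the cut-off unfolds to `PintTriv` at level `K − n`. [cite: Balaban1985UV3, (43) p.266] -/
theorem PintH_of_le {K n : ℕ} (h : n ≤ K) (V : GaugeField (F.P n) 0 (Matrix.specialUnitaryGroup (Fin 2) ℂ)) :
    D.PintH K n V = D.PintTriv K (K - n)
      (fieldShift (F.sitesPerDir_eq (m := F.m) (K := K) (j := K - n) (m' := F.m) (K' := n) (j' := 0) (by omega)) V) := by
  simp [PintH, h]

end AlphaDataT3

/-! ## §2 The 18916 envelopes: (41′)/(47′) for `ρ_j = resDensity F γ K univ j`, and the regularity of `up`/`low` (contract B1–B5) -/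

section Envelopes

variable {F : T3Family} {γ : ℝ} (D : AlphaDataT3 F γ)

/-- **(41′) — THE UPPER INDUCTIVE ASSUMPTION (41) FOR THE ROUTE'S `ℰp` DENSITY AT LEVEL `j` OF RUN `K`, CONSTANTS PULLED OUT** (hypothesis
schema, never asserted; contract B1): `ρ_j(W) ≤ e^{−E_j + Rm_j}·up_j(W)` for all `W` — (41) p.266 «ρ_k(V) ≤ Σ_{{Ω_j}} ∫dV_{k−1}↾_{Z_{k−1}} ⋯
exp[−(1/g_k²)A^η(U_k) + Σ_{j=1}^k Σ_{Y_j} 𝒫_j(Y_j,U_k) − E_k + Σ_{j<k} O(log g_j⁻¹)|Z_j| + Σ_{j<k} O((Lʲε)^{3+κ₀})|T₁^{(j)}|]» in the form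
`HistoryTailSandwich.rho_le_of_ineq41` gives it. [cite: Balaban1985UV3, (41) p.266] -/
def Ineq41At (K j : ℕ) : Prop :=
  ∀ W, resDensity F γ K Set.univ j W ≤ Real.exp (-(D.Ecst K j) + D.Rm K j) * D.up K j W

/-- **(47′) — THE LOWER INDUCTIVE ASSUMPTION (47), CONSTANTS PULLED OUT** (hypothesis schema, never asserted; contract B2):
`e^{−E_j − Rm_j}·low_j(W) ≤ ρ_j(W)` — (47) p.267 «ρ_k(V) ≥ χ_k exp[−(1/g_k²)A^η(U_k) + Σ_jΣ_{Y_j}𝒫_j(Y_j,U_k) − E_k − Σ_{j<k}O((Lʲε)^{3+κ₀})|T₁^{(j)}|]»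
in the form `HistoryTailSandwich.le_rho_of_ineq47` gives it. [cite: Balaban1985UV3, (47) p.267] -/
def Ineq47At (K j : ℕ) : Prop :=
  ∀ W, Real.exp (-(D.Ecst K j) - D.Rm K j) * D.low K j W ≤ resDensity F γ K Set.univ j W

/-- `χ_k` is a characteristic function: values in `[0, 1]` (hypothesis schema on the exposed datum). [cite: Balaban1985UV3, (47) p.267] -/
def ChiRange (D : AlphaDataT3 F γ) : Prop :=
  ∀ K j W, 0 ≤ D.χ K j W ∧ D.χ K j W ≤ 1

/-- **REGULARITY OF THE MINORANT/MAJORANT** (hypothesis schema, never asserted; contract B4/B5): `low_j` and `up_j` are integrable for the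
product Haar measure of level `j`, and the small-field trivial-history term has positive mass `0 < ∫ low_j` ((47) + the Gaussian lower bound
behind Thm 1 (5), pp.267, 273 «The lower bound is simpler, it is enough to use (44)–(46) and (66)»). [cite: Balaban1985UV3, (47) p.267 and (66) p.273] -/
def EnvelopeRegular (K j : ℕ) : Prop :=
  Integrable (D.low K j) (fieldMeasure (F.P K) j (Matrix.specialUnitaryGroup (Fin 2) ℂ)) ∧
    Integrable (D.up K j) (fieldMeasure (F.P K) j (Matrix.specialUnitaryGroup (Fin 2) ℂ)) ∧
      0 < ∫ W, D.low K j W ∂fieldMeasure (F.P K) j (Matrix.specialUnitaryGroup (Fin 2) ℂ)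

variable {D}

/-- B3 from the range of `χ`: `0 ≤ low_j(W)`. [cite: Balaban1985UV3, (47) p.267] -/
theorem low_nonneg (hχ : ChiRange D) (K j : ℕ) (W : GaugeField (F.P K) j (Matrix.specialUnitaryGroup (Fin 2) ℂ)) :
    0 ≤ D.low K j W :=
  mul_nonneg (hχ K j W).1 (Real.exp_nonneg _)

/-- B4 on events: integrability of `up_j` on the whole space gives it on every large-plaquette event. [cite: Balaban1985UV3, (41) p.266] -/
theorem integrableOn_up {K j : ℕ} (h : EnvelopeRegular D K j) (S : Set (GaugeField (F.P K) j (Matrix.specialUnitaryGroup (Fin 2) ℂ))) :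
    IntegrableOn (D.up K j) S (fieldMeasure (F.P K) j (Matrix.specialUnitaryGroup (Fin 2) ℂ)) :=
  h.2.1.integrableOn

/-- (47′) and `χ ≥ 0` give `ρ_j ≥ 0` back (consistency with `resDensity_nonneg`). [cite: Balaban1985UV3, (47) p.267] -/
theorem resDensity_lower_nonneg (hχ : ChiRange D) (K j : ℕ) (W : GaugeField (F.P K) j (Matrix.specialUnitaryGroup (Fin 2) ℂ)) :
    0 ≤ Real.exp (-(D.Ecst K j) - D.Rm K j) * D.low K j W :=
  mul_nonneg (Real.exp_nonneg _) (low_nonneg hχ K j W)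

end Envelopes

/-! ## §3 The printed SIZE facts as schemas: the remainder `Rm` ((41) last term, (44)–(46)), `|E_k|` ((65)), `Pint` at the trivial history ((46)) -/

section Sizes

variable {F : T3Family} {γ : ℝ} (D : AlphaDataT3 F γ)

/-- **THE SIZE OF THE REMAINDER** (hypothesis schema, never asserted; SPEC (3c), contract B6 in printed form): `0 ≤ Rm^{(K)}_j ≤
C·Σ_{i<j} q^{K−i}·|T_phys|` with `q = L^{−κ₀} ∈ (0, 1)` (so `q^{K−i} = (Lⁱε_K)^{κ₀}`, `ε_K = L^{−K}`) and `|T_phys| = (2L^m)³` the unit-lattice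
volume — (41) p.266 last term «Σ_{j=0}^{k−1} O((Lʲε)^{3+κ₀})|T₁^{(j)}|» with `|T₁^{(j)}| = (Lʲε)^{−3}|T_ε|` ((5) p.256), `κ₀ > 0`.
[cite: Balaban1985UV3, (41) p.266 and (5) p.256] -/
def RmSize (C q : ℝ) : Prop :=
  0 ≤ q ∧ q < 1 ∧ ∀ K j, j ≤ K → 0 ≤ D.Rm K j ∧
    D.Rm K j ≤ C * (∑ i ∈ Finset.range j, q ^ (K - i)) * (2 * (F.L : ℝ) ^ F.m) ^ 3

/-- **THE SIZE OF THE CONSTANTS `E_k`** (hypothesis schema, never asserted; SPEC (3c)): (65) p.273 «|E_k| ≤ O(1)Σ_{j=k}^{K−1}|T₁^{(j)}| =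
O(1)Σ_j L^{−3(j−k)}|T₁^{(k)}| ≤ O(1)|T₁^{(k)}|», `|T₁^{(k)}|` = the number of sites of level `k` of run `K` = `sitesPerDir^3`; and (64)
`E_k = Σ_{j=k}^{K−1} E^{(j)}`. [cite: Balaban1985UV3, (64)-(65) p.273] -/
def EcstSize (C : ℝ) : Prop :=
  (∀ K j, j ≤ K → D.Ecst K j = ∑ i ∈ Finset.Ico j K, D.Estep K i) ∧
    ∀ K j, j ≤ K → |D.Ecst K j| ≤ C * ((F.P K).sitesPerDir j : ℝ) ^ 3

/-- **THE SIZE OF THE INTERACTION SUM AT AN ADMISSIBLE PAIR** (hypothesis schema, never asserted; SPEC (3c)): (46) p.267 «Σ_{j=1}^k Σ_{Y_j}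
|𝒫_j(Y_j, U_k)| ≤ O(1)M₁³g²_{k−1}p²(g_{k−1})|Λ_k|» («Thus the sum is not only convergent, but also small»), with `|Λ_k| ≤ |T₁^{(k)}|`,
`g_{k−1}p(g_{k−1}) = θBal` at distance `K − k + 1` from the unit scale, `M₁³` in the constant; stated on the support `Adm` of the
characteristic functions (the regularity «|U_k(∂p) − 1| < 2L²B₃g_{k−1}p(g_{k−1})η²» p.267 under which (44)–(46) are derived).
[cite: Balaban1985UV3, (44)-(46) p.267] -/
def PintSize (b₀ p₀ C : ℝ) : Prop :=
  ∀ K j (h : D.Hist K j) W, j ≤ K → 1 ≤ j → D.Adm K j h W →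
    |D.Pint K j h W| ≤ C * θBal F.L γ b₀ p₀ (K - j + 1) ^ 2 * ((F.P K).sitesPerDir j : ℝ) ^ 3

/-- The three printed size clauses with SOME constants (the bundle the owner's v5 stub texts name `Sizes D`). [cite: Balaban1985UV3, (41) p.266, (46) p.267 and (65) p.273] -/
def Sizes (b₀ p₀ : ℝ) : Prop :=
  ∃ C q C' C'' : ℝ, RmSize D C q ∧ EcstSize D C' ∧ PintSize D b₀ p₀ C''

/-- **(43): THE INTERACTION SUM IS THE SUM OF ITS LOCALISED TERMS AT THE COMPOSITE MINIMISER** (hypothesis schema on the exposed data,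
never asserted; SPEC (3c), owner ruling g15-№1 (2) REQUIRED): `Pint^{(K)}_j(h, W) = Σ_{i=1}^{j} Σ_{Y ∈ Loc_i(h)} 𝒫_i(Y, U_j(h, W))` — (41)/(43)
p.266 «Σ_{j=1}^{k} Σ_{Y_j} 𝒫_j(Y_j, U_k)». [cite: Balaban1985UV3, (41) and (43) p.266] -/
def PintDecomp (D : AlphaDataT3 F γ) : Prop :=
  ∀ K j (h : D.Hist K j) W, D.Pint K j h W = ∑ i ∈ Finset.Icc 1 j, ∑ Y ∈ D.Loc K j h i, D.Pterm K i Y (D.Umin K j h W)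

/-- **LOCALITY OF THE INTERACTION TERMS** (hypothesis schema, never asserted; owner ruling g15-№1 (2) `IsLocal`): `𝒫_i(Y, U)` depends on
the fine configuration `U` only through its bond variables in the enlarged localisation `Ỹ` — p.263 «The second is a localization property
with respect to U₁. The expression 𝒫₁(g₀, X, U₁) depends on U₁ restricted to the set X̃ (let us recall that X̃ = ∪_{□⊂X} □̃)»; the general
step p.265 («identical to the expression on the right-hand side of (33)»). [cite: Balaban1985UV3, p.263 after (26) and (35) p.265] -/
def IsLocal (D : AlphaDataT3 F γ) : Prop :=
  ∀ K i (Y : Set (Site (F.P K) 0)) (U U' : GaugeField (F.P K) 0 (Matrix.specialUnitaryGroup (Fin 2) ℂ)),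
    (∀ b : PBond (F.P K) 0, b ∈ bondsIn 0 (D.enl K i Y) → U b = U' b) → D.Pterm K i Y U = D.Pterm K i Y U'

/-- **GAUGE INVARIANCE (26) OF THE INTERACTION TERMS** (hypothesis schema, never asserted): «𝒫₁(g₀, X, U₁^u) = 𝒫₁(g₀, X, U₁) for all
gauge transformations u» — the first of the three properties p.263. [cite: Balaban1985UV3, (26) p.263] -/
def GaugeInv26 (D : AlphaDataT3 F γ) : Prop :=
  ∀ K i (Y : Set (Site (F.P K) 0)), GaugeField.GaugeInvariant (D.Pterm K i Y)

/-- **THE PRINTED SIZE OF ONE INTERACTION TERM, (44)** (hypothesis schema, never asserted; owner ruling g15-№1 (2) `TermSize`): on the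
support of the characteristic functions, a level-`i` term of run `K` evaluated at the level-`j` composite minimiser obeys
`|𝒫_i(Y, U_j(h,W))| ≤ C·e^{−κ₁𝓛(Y)}·(g_{j−1}p(g_{j−1}))²·L^{−4(j−i)}` — (44) p.267 «|𝒫_j(Y_j, U_k)| ≤ O(1) Π_{i=1}^{n} exp(−κ₁(M₁Lʲη)^{−1}|c_{i,−} − y|)
·(Lʲη)^{−1}|c_{i,−} − y|·8L²B₃g_{k−1}p(g_{k−1})(Lʲη)²» with `n ≥ 2` bonds per domain (p.266 «n ≥ 2»; p.267 «the condition n ≥ 2 plays a crucial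
role»), `Lʲη = L^{−(k−j)}`, `g_{k−1}p(g_{k−1}) = θBal` at distance `K − k + 1` from the unit scale; READING: the polynomial factors are absorbed
into the tree decay (`κ₁` below print's) and two of the `n ≥ 2` small factors are kept (the others are `≤ 1`, (45)); summed: (46). [cite: Balaban1985UV3, (44)-(45) p.267] -/
def TermSize (b₀ p₀ C κ₁ : ℝ) : Prop :=
  0 < κ₁ ∧ ∀ K j (h : D.Hist K j) W, j ≤ K → D.Adm K j h W → ∀ i, 1 ≤ i → i ≤ j → ∀ Y ∈ D.Loc K j h i,
    |D.Pterm K i Y (D.Umin K j h W)| ≤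
      C * Real.exp (-κ₁ * D.treeLen K i Y) * θBal F.L γ b₀ p₀ (K - j + 1) ^ 2 * (((F.L : ℝ) ^ (j - i))⁻¹) ^ 4

variable {D}

/-- The geometric sum in `RmSize` is bounded uniformly in the cut-off: `Σ_{i<j} q^{K−i} ≤ 1/(1 − q)` for `j ≤ K`, `0 ≤ q < 1`. [folklore] -/
private theorem geom_sum_le {q : ℝ} (hq0 : 0 ≤ q) (hq1 : q < 1) {K j : ℕ} (hj : j ≤ K) :
    ∑ i ∈ Finset.range j, q ^ (K - i) ≤ (1 - q)⁻¹ := by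
  have hle : ∀ i ∈ Finset.range j, q ^ (K - i) ≤ q ^ (j - 1 - i) := by
    intro i hi
    have hij := Finset.mem_range.mp hi
    exact pow_le_pow_of_le_one hq0 hq1.le (by omega)
  calc ∑ i ∈ Finset.range j, q ^ (K - i) ≤ ∑ i ∈ Finset.range j, q ^ (j - 1 - i) := Finset.sum_le_sum hle
    _ = ∑ i ∈ Finset.range j, q ^ i := Finset.sum_range_reflect (fun i => q ^ i) j
    _ ≤ (1 - q)⁻¹ :=
        sum_le_hasSum (Finset.range j) (fun n _ => pow_nonneg hq0 n) (hasSum_geometric_of_lt_one hq0 hq1)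

/-- **B6 FROM THE PRINTED SIZE**: under `RmSize D C q` the factors `e^{2Rm_j}` are bounded uniformly in the cut-off `K` and the level
`j ≤ K` (volume-dependent, as the 18916 contract allows). [cite: Balaban1985UV3, (41) p.266] -/
theorem exp_two_Rm_le {C q : ℝ} (h : RmSize D C q) :
    ∃ CRm : ℝ, ∀ K j, j ≤ K → Real.exp (2 * D.Rm K j) ≤ CRm := by
  refine ⟨Real.exp (2 * (|C| * (1 - q)⁻¹ * (2 * (F.L : ℝ) ^ F.m) ^ 3)), fun K j hj => ?_⟩
  have hgeom := geom_sum_le h.1 h.2.1 hj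
  have hS0 : 0 ≤ ∑ i ∈ Finset.range j, q ^ (K - i) := Finset.sum_nonneg fun i _ => pow_nonneg h.1 _
  have hV0 : 0 ≤ (2 * (F.L : ℝ) ^ F.m) ^ 3 := by positivity
  refine Real.exp_le_exp.mpr (mul_le_mul_of_nonneg_left ?_ (by norm_num))
  calc D.Rm K j ≤ C * (∑ i ∈ Finset.range j, q ^ (K - i)) * (2 * (F.L : ℝ) ^ F.m) ^ 3 := (h.2.2 K j hj).2
    _ ≤ |C| * (∑ i ∈ Finset.range j, q ^ (K - i)) * (2 * (F.L : ℝ) ^ F.m) ^ 3 := by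
        gcongr; exact le_abs_self C
    _ ≤ |C| * (1 - q)⁻¹ * (2 * (F.L : ℝ) ^ F.m) ^ 3 := by gcongr

/-- Under `RmSize` the remainders are non-negative. [cite: Balaban1985UV3, (41) p.266] -/
theorem Rm_nonneg {C q : ℝ} (h : RmSize D C q) {K j : ℕ} (hj : j ≤ K) : 0 ≤ D.Rm K j := (h.2.2 K j hj).1

end Sizes

/-! ## §4 The composite minimiser: the constraint (42)/(67), the main term as `β_K·A(U_k)`, print's regularity (68) (contract C1–C2) -/

section Minimiser

variable {F : T3Family} {γ : ℝ} (D : AlphaDataT3 F γ)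

/-- **(42)/(67) AT THE TOP LEVEL** (hypothesis schema, never asserted; contract C1): for every admissible `(h, W)` the `j`-fold `ℰp`-average
of the composite minimiser EQUALS `W` on the bonds of `T^{(j)}` inside `Ω_j(h)` — (42) p.266 «U: Ū_j = V_j on Λ_j, j = 0, 1, …, k, … V_k = V»,
(67) p.273 «Ū_k^j = V_j on Λ_j»; at the trivial history `Ω_j = T_η` this is `avg^j(U_j(W)) = W` everywhere. [cite: Balaban1985UV3, (42) p.266 and (67) p.273] -/
def Constraint42Top (D : AlphaDataT3 F γ) : Prop :=
  ∀ K j (h : D.Hist K j) W, j ≤ K → D.Adm K j h W → ∀ b : PBond (F.P K) j, b ∈ bondsIn j (D.Ω K j h j) →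
    Averaging.iter (fun i => BlockAveraging.blockAvg (P := F.P K) (j := i) ℰp) j (D.Umin K j h W) b = W b

/-- At the trivial history every region is the whole torus (hypothesis schema on the exposed regions). [cite: Balaban1985UV3, (47) p.267 and p.272] -/
def TrivRegions (D : AlphaDataT3 F γ) : Prop :=
  ∀ K j i, D.Ω K j (D.triv K j) i = Set.univ

/-- **THE MAIN TERM IS THE WILSON ACTION OF THE COMPOSITE MINIMISER IN ROUTE UNITS** (hypothesis schema, never asserted; contract C1):
`mainT^{(K)}_j(h, W) = β_K · Σ_{q ⊂ T_η} [1 − Re tr U_j(h,W)(∂q)]` — print's «(1/g_k²)A^η(U_k)», `A^η(U_k) = Σ_{p⊂T_η} η^{−1}[1 − Re tr U_k(∂p)]`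
((5) p.256), the factor `η^{−1}/g_k² = 1/(g²ε)` being the route's `β_K` ((3) p.256: `g_k² = g²Lᵏε`, `η = L^{−k}`).
[cite: Balaban1985UV3, (5) p.256 and (41) p.266] -/
def MainTermIsAction (D : AlphaDataT3 F γ) : Prop :=
  ∀ K j (h : D.Hist K j) W, D.mainT K j h W = (F.scheme ℰp γ).β K * wilsonAction4 (D.Umin K j h W)

/-- **PRINT'S REGULARITY (68) OF THE COMPOSITE MINIMISER UNDER THE REGULAR REGION** (hypothesis schema, never asserted; contract C2 at the
finest level): for admissible `(h, W)` and every level `i ≤ j`, every fine plaquette `q` all of whose corners lie in `Λ_i(h)` satisfies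
`|U_j(h,W)(∂q) − 1| ≤ C68·g_ip(g_i)·L^{−2i}` with `g_ip(g_i) = θBal` at distance `K − i` from the unit scale — (68) p.273 «the configuration
U_k satisfies the following regularity condition on B_j(Λ_j): |U_k(∂p) − 1| < O(1)g_jp(g_j)L^{−2j}». [cite: Balaban1985UV3, (68) p.273] -/
def Regularity68 (b₀ p₀ C68 : ℝ) : Prop :=
  ∀ K j (h : D.Hist K j) W, j ≤ K → D.Adm K j h W → ∀ i, i ≤ j → ∀ q : Plaq (F.P K) 0, q ∈ plaqsIn 0 (D.Λ K j h i) →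
    GaugeGroup.dist1 (GaugeField.plaqHol (D.Umin K j h W) q) ≤
      C68 * θBal F.L γ b₀ p₀ (K - i) * (((F.L : ℝ) ^ i)⁻¹) ^ 2

/-- **THE 18916 CONSUMER'S MULTI-LEVEL PROFILE** (hypothesis schema, never asserted; contract C2 for `0 ≤ s ≤ i`): the `s`-fold
`ℰp`-average of the composite minimiser has its level-`s` plaquettes under the regular region `Λ_i(h)` within `C68·g_ip(g_i)·L^{−2(i−s)}` of
`1`.  A READING, not a citation: for `s = 0` it IS (68) p.273; for `0 < s ≤ i` it is (68) combined with the first-order averaging bound of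
[Balaban1985Averaging] §2 (tree `BlockAveragingPlaquetteBound`) — located, not printed as such. [cite: Balaban1985UV3, (68) p.273] -/
def Regularity68Levels (b₀ p₀ C68 : ℝ) : Prop :=
  ∀ K j (h : D.Hist K j) W, j ≤ K → D.Adm K j h W → ∀ i, i ≤ j → ∀ s, s ≤ i → ∀ q : Plaq (F.P K) s, q ∈ plaqsIn s (D.Λ K j h i) →
    GaugeGroup.dist1 (GaugeField.plaqHol
        (Averaging.iter (fun l => BlockAveraging.blockAvg (P := F.P K) (j := l) ℰp) s (D.Umin K j h W)) q) ≤
      C68 * θBal F.L γ b₀ p₀ (K - i) * (((F.L : ℝ) ^ (i - s))⁻¹) ^ 2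

/-- **THE HISTORY FUNCTIONAL IS MONOTONE AND CHARGES ONLY ADMISSIBLE PAIRS** (hypothesis schema on the exposed functional, never asserted;
contract C3, as `B10.TowerRun.lf_mono/lf_shift`): `LF_j(W)` is a positive linear combination of values `exp Φ(h)` over admissible `h` — monotone
in `Φ`, `LF(Φ + t) = eᵗ·LF(Φ)`, and independent of `Φ` off `{h | Adm h W}` (the characteristic functions of (41) vanish there).
[cite: Balaban1985UV3, (41) p.266] -/
def LFShape (D : AlphaDataT3 F γ) : Prop :=
  (∀ K j W (Φ Ψ : D.Hist K j → ℝ), (∀ h, D.Adm K j h W → Φ h ≤ Ψ h) → D.LF K j W Φ ≤ D.LF K j W Ψ) ∧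
    ∀ K j W (Φ : D.Hist K j → ℝ) (t : ℝ), D.LF K j W (fun h => Φ h + t) = Real.exp t * D.LF K j W Φ

variable {D}

/-- The multi-level profile at `s = 0` is print's (68). [cite: Balaban1985UV3, (68) p.273] -/
theorem regularity68_of_levels {b₀ p₀ C68 : ℝ} (h : Regularity68Levels D b₀ p₀ C68) : Regularity68 D b₀ p₀ C68 := by
  intro K j hh W hj hadm i hi q hq
  simpa [Averaging.iter] using h K j hh W hj hadm i hi 0 (Nat.zero_le i) q hq

/-- Under `LFShape`, two exponents that agree on admissible histories have the same `LF`. [cite: Balaban1985UV3, (41) p.266] -/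
theorem lf_congr_adm (hLF : LFShape D) {K j : ℕ} (W : GaugeField (F.P K) j (Matrix.specialUnitaryGroup (Fin 2) ℂ))
    {Φ Ψ : D.Hist K j → ℝ} (h : ∀ h, D.Adm K j h W → Φ h = Ψ h) : D.LF K j W Φ = D.LF K j W Ψ :=
  le_antisymm (hLF.1 K j W Φ Ψ fun h' hh => (h h' hh).le) (hLF.1 K j W Ψ Φ fun h' hh => (h h' hh).ge)

/-- (41′) ∧ (47′) ∧ `χ ≥ 0` give `0 ≤ up_j` (positivity is read from the sandwich, not from `LFShape`). [cite: Balaban1985UV3, (41) p.266 and (47) p.267] -/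
theorem up_nonneg_of_ineqs (hχ : ChiRange D) {K j : ℕ} (h41 : Ineq41At D K j) (h47 : Ineq47At D K j)
    (W : GaugeField (F.P K) j (Matrix.specialUnitaryGroup (Fin 2) ℂ)) : 0 ≤ D.up K j W := by
  have h0 : 0 ≤ Real.exp (-(D.Ecst K j) + D.Rm K j) * D.up K j W :=
    (resDensity_lower_nonneg hχ K j W).trans ((h47 W).trans (h41 W))
  exact (mul_nonneg_iff_of_pos_left (Real.exp_pos _)).mp h0

end Minimiser

/-! ## §5 The 19201 reading: SPEC (3a) THROUGH the existing socket `T3LogComparisonSocket` (data = the height readings of §1) -/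

section Heights

variable {F : T3Family} {γ : ℝ} (D : AlphaDataT3 F γ) (b₀ p₀ : ℝ)

/-- **(41) ∧ (47) AT THE TRIVIAL HISTORY FOR THE UV-SMALL-HISTORY HEIGHT DENSITIES, WITH THIS FILE'S DATA** (hypothesis schema, never
asserted; SPEC (3a)): ★ym-ust-19201-p2's socket `T3LogComparisonSocket.TwoSidedRepAt` at `Pint := PintH D`, `E := EcstH D`, `Rm := RmH D`
(`β_K·minActionRegPr = bgRegPr` at `n = ⌊K/m⌋` by `T3LogComparisonSocket.bgRegPr_eq`). [cite: Balaban1985UV3, (41) p.266 and (47) p.267] -/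
def RepAtHeights (ε₀ : ℝ) : Prop :=
  TwoSidedRepAt F γ b₀ p₀ ε₀ D.PintH D.EcstH D.RmH

/-- **THE CUT-OFF-CAUCHY PROPERTY OF THIS FILE'S INTERACTION DATA** (hypothesis schema, never asserted): the socket
`T3LogComparisonSocket.PintCauchyAt` at `Pint := PintH D` ([King1986] Thm 3.4 shape; located, unprinted for non-abelian d = 3).
[cite: King1986, Thm 3.4 (3.9) p.656] -/
def CauchyAtHeights (m : ℕ) : Prop :=
  PintCauchyAt F γ b₀ p₀ m D.PintH

end Heights

/-! ## §6 Anti-junk clauses (v1.1, requested by the 19201 consumer ★ym-ust-19201-p2, finding 0364c67c41f82510): the three FREE fields `Adm`, `enl`,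
`Umin` pinned to print, so that «∃ D, IsLocal D ∧ TermSize D ∧ Sizes D ∧ PintDecomp D ∧ RepAtHeights D» is Bałaban's theorem and not satisfiable by the
junk datum `Adm := ∅, enl := univ, Umin := a section of avg^j, Pterm := (log ρ + bg) ∘ avg^j, Rm := 0` (hypothesis schemas, never asserted) -/

section AntiJunk

variable {F : T3Family} {γ : ℝ} (D : AlphaDataT3 F γ) (b₀ p₀ : ℝ)

/-- **THE SUPPORT OF THE CHARACTERISTIC FUNCTIONS CONTAINS THE ROUTE'S WINDOW AT THE TRIVIAL HISTORY** (hypothesis schema, never asserted): a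
level-`j` datum of run `K` all of whose plaquette variables are within `θBal(K − j) = g_j p(g_j)` of `1` is admissible for the trivial history —
(47) p.267 «the characteristic function χ_k corresponds to the restrictions on V given by the conditions |U_k(∂p) − 1| < g_k p(g_k)η²» read
through [Balaban1985Variational] Thm 1 (9) (datum-small ⇒ minimiser-small, print's constant absorbed in `b₀`).  Makes `TermSize`/`PintSize`/
`Regularity68` bite on the window the cruxes quantify over. [cite: Balaban1985UV3, (47) p.267] -/
def AdmOnSmall : Prop :=
  ∀ K j (W : GaugeField (F.P K) j (Matrix.specialUnitaryGroup (Fin 2) ℂ)), j ≤ K →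
    PlaqSmall (θBal F.L γ b₀ p₀ (K - j)) W → D.Adm K j (D.triv K j) W

/-- **THE ENLARGED LOCALISATIONS ARE PRINT'S `X̃`** (hypothesis schema, never asserted): every site of `enl K i Y` lies within `r` big blocks of scale
`M₁L^i` of a site of `Y` — p.263 «𝒫₁(g₀, X, U₁) depends on U₁ restricted to the set X̃ (let us recall that X̃ = ∪_{□⊂X} □̃)», `□̃` = the cube with its
neighbours (so `r = 1` in print; `M₁`, `r` are the schema's parameters, to be fixed by the consumer).  Without this clause `IsLocal` is idle
(`enl := univ`). [cite: Balaban1985UV3, p.263 after (26)] -/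
def EnlBounded (M₁ : ℕ) (r : ℝ) : Prop :=
  ∀ K i (Y : Set (Site (F.P K) 0)), ∀ x ∈ D.enl K i Y, ∃ y ∈ Y, B10Eq38TorusDomains.bdist (F.P K) M₁ i x y ≤ r

/-- **AT THE TRIVIAL HISTORY THE COMPOSITE MINIMISER IS PRINT'S MINIMISER OVER THE TWO-CLAUSE REGULAR SPACE (6)(ε₀) OF THE DATUM** (hypothesis
schema, never asserted): for a `θBal(n)`-small datum `V` on the comparison lattice, `U_k(V)` read on run `K`'s tower lies in the route's
`regFibrePr F n K h ε₀ V` and attains `minActionRegPr` — [Balaban1985Variational] Thm 1 (8) p.279 «there exists a minimal orbit in the space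
𝔘_k({Ω_j}, B₃ε₁) ∩ 𝔅_k(V) … unique»; with `GaugeInv26` the interaction terms then see only the orbit (a free SECTION `Umin` could smuggle the whole
datum through its gauge / fine structure). [cite: Balaban1985Variational, Thm 1 (8) p.279] -/
def UminTrivIsRegMinimiser (ε₀ : ℝ) : Prop :=
  ∀ K n (h : n ≤ K) (V : GaugeField (F.P n) 0 (Matrix.specialUnitaryGroup (Fin 2) ℂ)), PlaqSmall (θBal F.L γ b₀ p₀ n) V →
    D.Umin K (K - n) (D.triv K (K - n))
        (fieldShift (F.sitesPerDir_eq (m := F.m) (K := K) (j := K - n) (m' := F.m) (K' := n) (j' := 0) (by omega)) V) ∈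
      regFibrePr F n K h ε₀ V ∧
    wilsonAction4 (D.Umin K (K - n) (D.triv K (K - n))
        (fieldShift (F.sitesPerDir_eq (m := F.m) (K := K) (j := K - n) (m' := F.m) (K' := n) (j' := 0) (by omega)) V)) =
      minActionRegPr F n K h ε₀ V

/-- **THE LOCALISATION DOMAINS ARE SUMMABLE AROUND EVERY SITE** (hypothesis schema, never asserted; for the consumers' summations, (45) p.267
«summation over all Y_j with y fixed yields …»): tree lengths are non-negative and `Σ_{Y ∈ Loc, Y ∋ y} e^{−κ₁𝓛(Y)} ≤ C` uniformly.
[cite: Balaban1985UV3, (45) p.267] -/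
def LocCover (κ₁ C : ℝ) : Prop :=
  (∀ K i Y, 0 ≤ D.treeLen K i Y) ∧
    ∀ K j (h : D.Hist K j) i (y : Site (F.P K) 0),
      ∑ Y ∈ D.Loc K j h i, Y.indicator (fun _ => Real.exp (-κ₁ * D.treeLen K i Y)) y ≤ C

end AntiJunk

/-! ## §7 (v1.2, typer g40 — interface pen; director-ym LINE №20 (a)) The A.E. forms of (41′)/(47′) (pub-balaban3d-alpha-1 finding F-α1-2:
`resDensity` is the raw iterated Radon–Nikodym transport, a CHOSEN version, so (41)/(47) can be delivered only `dV`-almost everywhere), and the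
ROUTE-NORMALISED bookkeeping of the constants `E_k` — ERRATUM to §3: `EcstSize` types (64)/(65) in print's normalisation `ρ₀ = e^{−(1/g₀²)A − E}`
((1) p.256), whereas the route's `resDensity` starts from `e^{−β_K A}` WITHOUT `e^{−E}`; the deliverable constant is `E_k − E = −Σ_{i<k} E^{(i)}`
(`E = Σ_{j<K} E^{(j)}` by (64), so that `E_K = 0`), for which `EcstSize` fails; `EcstBook`/`SizesR` below are the satisfiable replacements and
`Sizes` (§3) must not be used in stub texts.  v1.3 (typer g41, OWNER RULING ym3-torus-plan g16-№1 (D); crux-idea card C1 `ecst-gaussian-mass-obstruction`,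
evidence #58 on stmt-QuantumFields-19201, UPHELD): v1.2's `EcstBook` kept `EcstSize`'s `K`-UNIFORM constant in its clause (ii) — but the route's tower is
mass-preserving Radon–Nikodym transport of `1_S·e^{−β_K A}` against Haar PROBABILITY measures, so after `k ≥ 1` steps the Gaussian fibre mass gives
`log ρ + β_K·minA = −(rank/2)·log β_K + O(N₀)` on the window, i.e. `Ecst K (K−n) ≍ 3N₀·log β_K` with `β_K = L^K/γ → ∞` INSIDE one datum (`D` quantifies
`∀ K`); with `RepAtHeights`, `RmSize`, `PintSize`/`AdmOnSmall` this made the v1.1 package `T3AlphaInputsACSchemas.AlphaInputsT3AC` UNSATISFIABLE at every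
`L`.  Print carries the logarithm: (22) p.261 «d(𝔤) denotes a dimension of the Lie algebra» (the Jacobian of `A → g₀A`), p.265 «We have to supplement also
the constants in (22), involving log σ₀ and log g₀, to the whole lattice», (62) p.271, (65) p.273 — and so does the tree's own audited bookkeeping
(`B10.lean` :53–66, cell GAPS G-B10-01 / DIVERGENCE D-b10.3 «E^{(k)} of (62) contains d(𝔤) log g_k |T₁^{(k)*}|, so the O(1) of (65)/(66)/(5) is
≥ c·d(𝔤)·|log g_k|»; `B10.Estep62_abs_le` / `Ek_abs_le` / `Ecst_abs_le`).  ERRATUM: (1) the `EcstBook` conjunct LEAVES the bundle `SizesR` (nobody consumes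
an `E`-size at proof level: `κ_K` is free in 19201's comparison and `E_k` cancels in 18916's ratio); (2) `EcstBook` stays BY NAME as an OPTIONAL bookkeeping
schema with clause (ii) re-typed LOG-AFFINE in `log β_K` and `i·log L` (`g_i^{(K)2} = γL^{−(K−i)}`); (3) every name and arity is kept, §3 untouched -/

section AEForms

variable {F : T3Family} {γ : ℝ} (D : AlphaDataT3 F γ)

/-- **(41′) ALMOST EVERYWHERE** (hypothesis schema, never asserted): `ρ_j(W) ≤ e^{−E_j + Rm_j}·up_j(W)` for `dV`-a.e. `W` — (41) p.266 for the
route's `ℰp` density read as the Radon–Nikodym version it is (the only form a construction can deliver; the consumers integrate, so nothing is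
lost: `setIntegral_mono_ae`). [cite: Balaban1985UV3, (41) p.266] -/
def Ineq41AE (K j : ℕ) : Prop :=
  ∀ᵐ W ∂fieldMeasure (F.P K) j (Matrix.specialUnitaryGroup (Fin 2) ℂ),
    resDensity F γ K Set.univ j W ≤ Real.exp (-(D.Ecst K j) + D.Rm K j) * D.up K j W

/-- **(47′) ALMOST EVERYWHERE** (hypothesis schema, never asserted): `e^{−E_j − Rm_j}·low_j(W) ≤ ρ_j(W)` for `dV`-a.e. `W` — (47) p.267, same
reading. [cite: Balaban1985UV3, (47) p.267] -/
def Ineq47AE (K j : ℕ) : Prop :=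
  ∀ᵐ W ∂fieldMeasure (F.P K) j (Matrix.specialUnitaryGroup (Fin 2) ℂ),
    Real.exp (-(D.Ecst K j) - D.Rm K j) * D.low K j W ≤ resDensity F γ K Set.univ j W

variable {D}

/-- The pointwise (41′) gives the a.e. form. [cite: Balaban1985UV3, (41) p.266] -/
theorem Ineq41At.ae {K j : ℕ} (h : Ineq41At D K j) : Ineq41AE D K j :=
  ae_of_all _ h

/-- The pointwise (47′) gives the a.e. form. [cite: Balaban1985UV3, (47) p.267] -/
theorem Ineq47At.ae {K j : ℕ} (h : Ineq47At D K j) : Ineq47AE D K j :=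
  ae_of_all _ h

/-- Under the a.e. sandwich and `χ ≥ 0`, `ρ_j` dominates a non-negative function a.e. and `up_j ≥ 0` a.e. (the a.e. twin of
`up_nonneg_of_ineqs`). [cite: Balaban1985UV3, (41) p.266 and (47) p.267] -/
theorem up_nonneg_ae (hχ : ChiRange D) {K j : ℕ} (h41 : Ineq41AE D K j) (h47 : Ineq47AE D K j) :
    ∀ᵐ W ∂fieldMeasure (F.P K) j (Matrix.specialUnitaryGroup (Fin 2) ℂ), 0 ≤ D.up K j W := by
  filter_upwards [h41, h47] with W h1 h2
  have h0 : 0 ≤ Real.exp (-(D.Ecst K j) + D.Rm K j) * D.up K j W :=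
    (resDensity_lower_nonneg hχ K j W).trans (h2.trans h1)
  exact (mul_nonneg_iff_of_pos_left (Real.exp_pos _)).mp h0

variable (D)

/-- **THE CONSTANTS `E_k` IN THE ROUTE'S NORMALISATION** (OPTIONAL bookkeeping schema, never asserted and — since v1.3 — NOT a clause of the bundle
`SizesR` nor of the package; ERRATUM-replacement of `EcstSize`): with `resDensity`'s start `e^{−β_K A}` (no `e^{−E}`), the constant in (41)/(47) at level
`j` is `E_j − E = −Σ_{i<j} E^{(i)}`, so (i) `Ecst K j = −Σ_{i<j} Estep K i` — (62) p.271 «The constant E_{k+1} is defined as E_{k+1} = E_k − E^{(k)}» — and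
(ii) each step constant has the printed size, WHICH IS LOG-AFFINE IN THE COUPLING: (65) p.273 «From (25), which holds for arbitrary j, we get easily
|E^{(j)}| ≤ O(1)|T₁^{(j)}|» where the `O(1)` carries the normalisation constants of (22) p.261 («d(𝔤) denotes a dimension of the Lie algebra»; p.265 «the
constants in (22), involving log σ₀ and log g₀») — the tree's audited reading `B10.lean` :53–66 / `B10.Estep62_abs_le`: «O(1)|T₁^{(j)}| with O(1) AFFINE IN
|log g_j|».  In the route's units `g_i^{(K)2} = γL^{−(K−i)} = L^i/β_K`, so `|log g_i^{(K)}|` is affine in `|log β_K|` and `i·log L`: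
`|Estep K i| ≤ C·(1 + |log β_K| + i·log L)·|T₁^{(i)}|`, `|T₁^{(i)}|` = `sitesPerDir i ^ 3`.  v1.3 ERRATUM (OWNER RULING g16-№1 (D), card C1 evidence #58): v1.2 had
the `K`-uniform `C·|T₁^{(i)}|` here, unsatisfiable against the route's mass-preserving tower (`Ecst K (K−n) ≍ 3N₀·log β_K`, `β_K → ∞` inside one datum).
NON-VACUITY (C1 kill-test (i)): in the abelian/Gaussian toy — quadratic action, linear averaging — the identity `log T^k(e^{−βq})(ψ) + β·min q =
−((N₀−N_k)/2)·log β + c` is exact, so its step constants are `E^{(i)} = −(3(N_i − N_{i+1})/2)·log β_K + O(N_i)` and satisfy (ii) with `C = O(1)`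
(`3·log β_K·(N_i − N_{i+1}) ≤ 3(1 + |log β_K|)·N_i`). [cite: Balaban1985UV3, (62) p.271, (65) p.273 and (22) p.261] -/
def EcstBook (C : ℝ) : Prop :=
  (∀ K j, j ≤ K → D.Ecst K j = -∑ i ∈ Finset.range j, D.Estep K i) ∧
    ∀ K i, i < K → |D.Estep K i| ≤
      C * (1 + |Real.log ((F.scheme ℰp γ).β K)| + i * Real.log F.L) * ((F.P K).sitesPerDir i : ℝ) ^ 3

/-- **THE CORRECTED SIZE BUNDLE** (replaces §3 `Sizes` in every stub text): the printed sizes of the remainder ((41) last term) and of the interaction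
sum ((46)), each with SOME constants.  v1.3 ERRATUM (OWNER RULING g16-№1 (D), card C1): the `E`-size conjunct `∃ C, EcstBook D C` of v1.2 is REMOVED
from the bundle — no consumer uses an `E`-size at proof level (the comparison constant `κ_K` of crux 19201 is free and absorbs `ΔE`; `E_k` cancels in crux
18916's ratio), and with the `K`-uniform (ii) of v1.2 it made the package unsatisfiable; `EcstBook` remains available by name as optional bookkeeping.
[cite: Balaban1985UV3, (41) p.266 and (46) p.267] -/
def SizesR (b₀ p₀ : ℝ) : Prop :=
  (∃ C q : ℝ, RmSize D C q) ∧ ∃ C : ℝ, PintSize D b₀ p₀ C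

variable {D}

/-- Under `EcstBook` the level-`j` constant is bounded by the finer volumes with the log-affine factor (v1.3):
`|Ecst K j| ≤ C·Σ_{i<j} (1 + |log β_K| + i·log L)·|T₁^{(i)}|`. [cite: Balaban1985UV3, (65) p.273] -/
theorem EcstBook.abs_Ecst_le {C : ℝ} (h : EcstBook D C) {K j : ℕ} (hj : j ≤ K) :
    |D.Ecst K j| ≤ C * ∑ i ∈ Finset.range j,
      (1 + |Real.log ((F.scheme ℰp γ).β K)| + i * Real.log F.L) * ((F.P K).sitesPerDir i : ℝ) ^ 3 := by
  rw [h.1 K j hj, abs_neg, Finset.mul_sum]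
  refine (Finset.abs_sum_le_sum_abs _ _).trans (Finset.sum_le_sum fun i hi => ?_)
  rw [← mul_assoc]
  exact h.2 K i (lt_of_lt_of_le (Finset.mem_range.mp hi) hj)

/-- `SizesR` gives contract B6 (cut-off-uniform `e^{2Rm_j} ≤ C_Rm`) through `exp_two_Rm_le`. [cite: Balaban1985UV3, (41) p.266] -/
theorem SizesR.exp_two_Rm_le {b₀ p₀ : ℝ} (h : SizesR D b₀ p₀) :
    ∃ CRm : ℝ, ∀ K j, j ≤ K → Real.exp (2 * D.Rm K j) ≤ CRm := by
  obtain ⟨⟨C, q, hR⟩, -⟩ := h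
  exact T3AlphaInputsAC.exp_two_Rm_le hR

end AEForms

end Literature.MathematicalPhysics.QuantumFieldTheory.Balaban1983to89.T3AlphaInputsAC

end
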